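import Summits.KontsevichZagierPeriods.Zeta5Search.Certificates.TwoTaleTelescopeER

/-!
# (bmiss)@Ω — cert-2's certificate atoms of direction `e`, evaluated (cell `pub-zeta5`, cert-1 gen 4)

HONEST FRAMING: systematic search; recurrence certificates; no irrationality claim unless certified. Pure algebra over `ℚ`.

Values of the opaque atoms of `Certificates.TwoTaleTelescope.telescope_e_L` (variable `t`) and `telescope_e_R` (at `t = u/2`,
`u` the lattice variable): the Γ-ratio linear-form products `lprod numE•k/denE•k/tnE•/tdE•/cnumE•/cnumSE•/cdenE•/cdenSE•`, and the
certificate numerators — the cubic `x_L(t) = Σ_{j<4} x_j t^j` of side `L` as an explicit polynomial `xPolyEL` in `ℚ[X]`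
(`eval_xPolyEL : (xPolyEL …).eval (t+s) = polyTN xEL s … t`) and the `t`-free `x_R` (`xERv`, `polyTN_xER`).
-/

noncomputable section

open Polynomial
open Summit.KontsevichZagierPeriods.Zeta5Search.Certificates.TwoTaleTelescope

namespace Summit.KontsevichZagierPeriods.Zeta5Search.TwoTaleOmega

/-- Value of cert-2's atom `lprod numEL1`. -/
theorem numEL1_eval (a b e f g t : ℚ) : lprod numEL1 a b e f g t = (e + t) * (a - e + t) := by
  simp only [lprod_cons, lprod_nil, lval, numEL1, List.getD_cons_zero, List.getD_cons_succ]
  push_cast; ring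

/-- Value of cert-2's atom `lprod numEL2`. -/
theorem numEL2_eval (a b e f g t : ℚ) : lprod numEL2 a b e f g t = (e + t) * (e + t + 1) * (a - e + t) * (a - e + t - 1) := by
  simp only [lprod_cons, lprod_nil, lval, numEL2, List.getD_cons_zero, List.getD_cons_succ]
  push_cast; ring

/-- Value of cert-2's atom `lprod numEL3`. -/
theorem numEL3_eval (a b e f g t : ℚ) : lprod numEL3 a b e f g t = (e + t) * (e + t + 1) * (e + t + 2) * (a - e + t) * (a - e + t - 1) * (a - e + t - 2) := by
  simp only [lprod_cons, lprod_nil, lval, numEL3, List.getD_cons_zero, List.getD_cons_succ]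
  push_cast; ring

/-- Value of cert-2's atom `lprod tnEL`. -/
theorem tnEL_eval (a b e f g t : ℚ) : lprod tnEL a b e f g t = (a + t) * (b + t) * (e + t) * (f + t) := by
  simp only [lprod_cons, lprod_nil, lval, tnEL, List.getD_cons_zero, List.getD_cons_succ]
  push_cast; ring

/-- Value of cert-2's atom `lprod tdEL`. -/
theorem tdEL_eval (a b e f g t : ℚ) : lprod tdEL a b e f g t = (t + 1) * (a - e + t + 1) * (a - f + t + 1) * (g + t) := by
  simp only [lprod_cons, lprod_nil, lval, tdEL, List.getD_cons_zero, List.getD_cons_succ]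
  push_cast; ring

/-- Value of cert-2's atom `lprod cnumEL`. -/
theorem cnumEL_eval (a b e f g t : ℚ) : lprod cnumEL a b e f g t = (t) * (a - e + t) * (a - f + t) * (g + t - 1) := by
  simp only [lprod_cons, lprod_nil, lval, cnumEL, List.getD_cons_zero, List.getD_cons_succ]
  push_cast; ring

/-- Value of cert-2's atom `lprod cnumSEL`. -/
theorem cnumSEL_eval (a b e f g t : ℚ) : lprod cnumSEL a b e f g t = (t + 1) * (a - e + t + 1) * (a - f + t + 1) * (g + t) := by
  simp only [lprod_cons, lprod_nil, lval, cnumSEL, List.getD_cons_zero, List.getD_cons_succ]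
  push_cast; ring

/-- Value of cert-2's atom `lprod numER1` at `t = u/2`. -/
theorem numER1_eval (a b e f g u : ℚ) : lprod numER1 a b e f g (u / 2) = (-a + e + f) * (e) * (e + u / 2) := by
  simp only [lprod_cons, lprod_nil, lval, numER1, List.getD_cons_zero, List.getD_cons_succ]
  push_cast; ring

/-- Value of cert-2's atom `lprod numER2` at `t = u/2`. -/
theorem numER2_eval (a b e f g u : ℚ) : lprod numER2 a b e f g (u / 2) = (-a + e + f) * (-a + e + f + 1) * (e) * (e + 1) * (e + u / 2) * (e + u / 2 + 1) := by
  simp only [lprod_cons, lprod_nil, lval, numER2, List.getD_cons_zero, List.getD_cons_succ]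
  push_cast; ring

/-- Value of cert-2's atom `lprod numER3` at `t = u/2`. -/
theorem numER3_eval (a b e f g u : ℚ) : lprod numER3 a b e f g (u / 2) = (-a + e + f) * (-a + e + f + 1) * (-a + e + f + 2) * (e) * (e + 1) * (e + 2) * (e + u / 2) * (e + u / 2 + 1) * (e + u / 2 + 2) := by
  simp only [lprod_cons, lprod_nil, lval, numER3, List.getD_cons_zero, List.getD_cons_succ]
  push_cast; ring

/-- Value of cert-2's atom `lprod denER1` at `t = u/2`. -/
theorem denER1_eval (a b e f g u : ℚ) : lprod denER1 a b e f g (u / 2) = (e + f + u / 2) := by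
  simp only [lprod_cons, lprod_nil, lval, denER1, List.getD_cons_zero, List.getD_cons_succ]
  push_cast; ring

/-- Value of cert-2's atom `lprod denER2` at `t = u/2`. -/
theorem denER2_eval (a b e f g u : ℚ) : lprod denER2 a b e f g (u / 2) = (e + f + u / 2) * (e + f + u / 2 + 1) := by
  simp only [lprod_cons, lprod_nil, lval, denER2, List.getD_cons_zero, List.getD_cons_succ]
  push_cast; ring

/-- Value of cert-2's atom `lprod denER3` at `t = u/2`. -/
theorem denER3_eval (a b e f g u : ℚ) : lprod denER3 a b e f g (u / 2) = (e + f + u / 2) * (e + f + u / 2 + 1) * (e + f + u / 2 + 2) := by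
  simp only [lprod_cons, lprod_nil, lval, denER3, List.getD_cons_zero, List.getD_cons_succ]
  push_cast; ring

/-- Value of cert-2's atom `lprod tnER` at `t = u/2`. -/
theorem tnER_eval (a b e f g u : ℚ) : lprod tnER a b e f g (u / 2) = (a - b + g + u) * (a - b + g + u + 1) * (a + u / 2) * (e + u / 2) * (f + u / 2) := by
  simp only [lprod_cons, lprod_nil, lval, tnER, List.getD_cons_zero, List.getD_cons_succ]
  push_cast; ring

/-- Value of cert-2's atom `lprod tdER` at `t = u/2`. -/
theorem tdER_eval (a b e f g u : ℚ) : lprod tdER a b e f g (u / 2) = (a + u + 1) * (a + u + 2) * (a - b + u / 2 + 1) * (e + f + u / 2) * (g + u / 2) := by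
  simp only [lprod_cons, lprod_nil, lval, tdER, List.getD_cons_zero, List.getD_cons_succ]
  push_cast; ring

/-- Value of cert-2's atom `lprod cnumER` at `t = u/2`. -/
theorem cnumER_eval (a b e f g u : ℚ) : lprod cnumER a b e f g (u / 2) = (a + u - 1) * (a + u) * (a - b + u / 2) * (g + u / 2 - 1) * (e + f + u / 2 + 2) := by
  simp only [lprod_cons, lprod_nil, lval, cnumER, List.getD_cons_zero, List.getD_cons_succ]
  push_cast; ring

/-- Value of cert-2's atom `lprod cnumSER` at `t = u/2`. -/
theorem cnumSER_eval (a b e f g u : ℚ) : lprod cnumSER a b e f g (u / 2) = (a + u + 1) * (a + u + 2) * (a - b + u / 2 + 1) * (g + u / 2) * (e + f + u / 2 + 3) := by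
  simp only [lprod_cons, lprod_nil, lval, cnumSER, List.getD_cons_zero, List.getD_cons_succ]
  push_cast; ring

/-- Value of cert-2's atom `lprod cdenER` at `t = u/2`. -/
theorem cdenER_eval (a b e f g u : ℚ) : lprod cdenER a b e f g (u / 2) = (e + f + u / 2) * (e + f + u / 2 + 1) * (e + f + u / 2 + 2) := by
  simp only [lprod_cons, lprod_nil, lval, cdenER, List.getD_cons_zero, List.getD_cons_succ]
  push_cast; ring

/-- Value of cert-2's atom `lprod cdenSER` at `t = u/2`. -/
theorem cdenSER_eval (a b e f g u : ℚ) : lprod cdenSER a b e f g (u / 2) = (e + f + u / 2 + 1) * (e + f + u / 2 + 2) * (e + f + u / 2 + 3) := by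
  simp only [lprod_cons, lprod_nil, lval, cdenSER, List.getD_cons_zero, List.getD_cons_succ]
  push_cast; ring

/-- The empty atoms of direction `e`. -/
theorem lprod_E_nil (a b e f g t : ℚ) : lprod numEL0 a b e f g t = 1 ∧ lprod denEL0 a b e f g t = 1 ∧ lprod denEL1 a b e f g t = 1 ∧
    lprod denEL2 a b e f g t = 1 ∧ lprod denEL3 a b e f g t = 1 ∧ lprod cdenEL a b e f g t = 1 ∧ lprod cdenSEL a b e f g t = 1 ∧
    lprod numER0 a b e f g t = 1 ∧ lprod denER0 a b e f g t = 1 := by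
  simp [numEL0, denEL0, denEL1, denEL2, denEL3, cdenEL, cdenSEL, numER0, denER0]

/-- The `j`-th coefficient `x_j(a,b,e,f,g)` of the side-`L` certificate numerator of direction `e`. -/
def xELc (j : ℕ) (a b e f g : ℚ) : ℚ := spvalC (xEL.getD j []) a b e f g

/-- The side-`L` certificate numerator of direction `e` as a polynomial in `t`: `x_L = x₀ + x₁X + x₂X² + x₃X³`. -/
def xPolyEL (a b e f g : ℚ) : ℚ[X] :=
  C (xELc 0 a b e f g) + C (xELc 1 a b e f g) * X + C (xELc 2 a b e f g) * X ^ 2 + C (xELc 3 a b e f g) * X ^ 3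

/-- `x_L` evaluated at `t + s` is cert-2's atom `polyTN xEL s`. -/
theorem eval_xPolyEL (s : ℤ) (a b e f g t : ℚ) : (xPolyEL a b e f g).eval (t + s) = polyTN xEL s a b e f g t := by
  have hl : xEL.length = 4 := rfl
  simp only [polyTN, hl, xPolyEL, xELc, eval_add, eval_mul, eval_C, eval_X, eval_pow]
  simp [List.range_succ]
  ring

/-- `deg x_L ≤ 3`. -/
theorem natDegree_xPolyEL_le (a b e f g : ℚ) : (xPolyEL a b e f g).natDegree ≤ 3 := by
  unfold xPolyEL
  refine (natDegree_add_le _ _).trans (max_le ((natDegree_add_le _ _).trans (max_le ((natDegree_add_le _ _).trans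
    (max_le ?_ ?_)) ?_)) ?_)
  · exact (natDegree_C _).le.trans (by norm_num)
  · exact (natDegree_C_mul_le _ _).trans (natDegree_X_le.trans (by norm_num))
  · exact (natDegree_C_mul_le _ _).trans ((natDegree_pow_le).trans (by simp))
  · exact (natDegree_C_mul_le _ _).trans ((natDegree_pow_le).trans (by simp))

/-- The (t-free) side-`R` certificate numerator `x_R(a,b,e,f,g)` of direction `e`. -/
def xERv (a b e f g : ℚ) : ℚ := spvalC (xER.getD 0 []) a b e f g

/-- cert-2's atom `polyTN xER s` is the constant `x_R`. -/
theorem polyTN_xER (s : ℤ) (a b e f g t : ℚ) : polyTN xER s a b e f g t = xERv a b e f g := by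
  have hl : xER.length = 1 := rfl
  simp [polyTN, hl, xERv]

end Summit.KontsevichZagierPeriods.Zeta5Search.TwoTaleOmega

end
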